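import Mathlib
import Summits.Ventures.PercRepro2.ZeroEdge
import Summits.Ventures.PercRepro2.StarOMain

/-!
# The two-coin faces of class O: `a₃` adjacent only to one root and `o` (blind cell PercRepro2,
night-1 g9; NIGHT1-G9.md §4)

A class theorem for a star with three coins yields every face of the star by setting the missing
coin to `0`: adjoin the missing edge with weight `0` (`ZeroEdge`), apply the class theorem, and
transport back (`HMF_ext_iff`).  Here: (HMF), hence (HCOV), whenever `a₃` is adjacent only to
`a₁` and `o` (`HMF_star_a1o`), only to `a₂` and `o` (`HMF_star_a2o`) — from `StarO.HMF_star_o`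
(the `b`-faces of class B are in StarFacesB).
-/

namespace Summit.Ventures.PercRepro2

namespace StarFaces

variable {V : Type*} {E : Type*} [Fintype E] [DecidableEq E] [Fintype V] [DecidableEq V]
  {R : Type*} [Field R] [LinearOrder R] [IsStrictOrderedRing R]

variable (p : E → R) (ends : E → Sym2 V) {f₁ f₂ f₃ : E} {a₃ a₁ a₂ o b : V}

/-- **(HMF) when `a₃` is adjacent only to `a₁` and `o`** (the `β = 0` face of class O). -/
theorem HMF_star_a1o (hp : IsProbVec p) (hf₁ : ends f₁ = s(a₃, a₁)) (hf₃ : ends f₃ = s(a₃, o))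
    (hstar : ∀ e, a₃ ∈ ends e → e = f₁ ∨ e = f₃) (h31 : a₃ ≠ a₁) (h32 : a₃ ≠ a₂) (h3o : a₃ ≠ o)
    (h3b : a₃ ≠ b) (h12 : a₁ ≠ a₂) (h1o : a₁ ≠ o) (h2o : a₂ ≠ o) : HMF p ends o a₁ a₂ a₃ b := by
  rw [← ZeroEdge.HMF_ext_iff p ends s(a₃, a₂)]
  exact StarO.HMF_star_o (ZeroEdge.p' p) (ZeroEdge.ends' ends s(a₃, a₂)) (ZeroEdge.isProbVec_p' hp)
    (f₁ := some f₁) (f₂ := none) (f₃ := some f₃) hf₁ rfl hf₃ (ZeroEdge.hstar_ext ends hstar) h31 h32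
    h3o h3b h12 h1o h2o

/-- **(HMF) when `a₃` is adjacent only to `a₂` and `o`** (the `α = 0` face of class O). -/
theorem HMF_star_a2o (hp : IsProbVec p) (hf₂ : ends f₂ = s(a₃, a₂)) (hf₃ : ends f₃ = s(a₃, o))
    (hstar : ∀ e, a₃ ∈ ends e → e = f₂ ∨ e = f₃) (h31 : a₃ ≠ a₁) (h32 : a₃ ≠ a₂) (h3o : a₃ ≠ o)
    (h3b : a₃ ≠ b) (h12 : a₁ ≠ a₂) (h1o : a₁ ≠ o) (h2o : a₂ ≠ o) : HMF p ends o a₁ a₂ a₃ b := by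
  rw [← ZeroEdge.HMF_ext_iff p ends s(a₃, a₁)]
  have hstar' : ∀ e, a₃ ∈ ZeroEdge.ends' ends s(a₃, a₁) e → e = none ∨ e = some f₂ ∨ e = some f₃ := by
    intro e he
    rcases ZeroEdge.hstar_ext ends hstar e he with h | h | h
    · exact Or.inr (Or.inl h)
    · exact Or.inl h
    · exact Or.inr (Or.inr h)
  exact StarO.HMF_star_o (ZeroEdge.p' p) (ZeroEdge.ends' ends s(a₃, a₁)) (ZeroEdge.isProbVec_p' hp)
    (f₁ := none) (f₂ := some f₂) (f₃ := some f₃) rfl hf₂ hf₃ hstar' h31 h32 h3o h3b h12 h1o h2o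

/-- (HCOV) for the face `{a₁, o}`. -/
theorem HCov_star_a1o (hp : IsProbVec p) (hf₁ : ends f₁ = s(a₃, a₁)) (hf₃ : ends f₃ = s(a₃, o))
    (hstar : ∀ e, a₃ ∈ ends e → e = f₁ ∨ e = f₃) (h31 : a₃ ≠ a₁) (h32 : a₃ ≠ a₂) (h3o : a₃ ≠ o)
    (h3b : a₃ ≠ b) (h12 : a₁ ≠ a₂) (h1o : a₁ ≠ o) (h2o : a₂ ≠ o) : CovForm.HCov p ends o a₁ a₂ a₃ b :=
  HCov_of_HMF p hp ends o a₁ a₂ a₃ b (HMF_star_a1o p ends hp hf₁ hf₃ hstar h31 h32 h3o h3b h12 h1o h2o)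

/-- (HCOV) for the face `{a₂, o}`. -/
theorem HCov_star_a2o (hp : IsProbVec p) (hf₂ : ends f₂ = s(a₃, a₂)) (hf₃ : ends f₃ = s(a₃, o))
    (hstar : ∀ e, a₃ ∈ ends e → e = f₂ ∨ e = f₃) (h31 : a₃ ≠ a₁) (h32 : a₃ ≠ a₂) (h3o : a₃ ≠ o)
    (h3b : a₃ ≠ b) (h12 : a₁ ≠ a₂) (h1o : a₁ ≠ o) (h2o : a₂ ≠ o) : CovForm.HCov p ends o a₁ a₂ a₃ b :=
  HCov_of_HMF p hp ends o a₁ a₂ a₃ b (HMF_star_a2o p ends hp hf₂ hf₃ hstar h31 h32 h3o h3b h12 h1o h2o)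

end StarFaces

end Summit.Ventures.PercRepro2
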